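import Literature.Computability.QuantumComplexity.ShallowCircuits
import Literature.Computability.QuantumComplexity.ReversibleCliffordT
import Literature.Computability.Cryptography.QuantumCircuitProofs
import Literature.Computability.Cryptography.QubitRegisterCliffordTProofs
import HarnessLib

/-!
# Quantum advantage with shallow circuits — the constant-depth quantum circuit (proofs)

Sibling "proofs" file of `Literature/Computability/QuantumComplexity/ShallowCircuits.lean`
(family `quantum-advantage`, statement **quantum-advantage.S23**, first half). It discharges the
named fact

* `Literature.QuantumAdvantage.hlf_quantum_constant_depth_holds : hlf_quantum_constant_depth` —
  Bravyi–Gosset–König, *Quantum advantage with shallow circuits*, Theorem 1 (arXiv p. 6): "For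
  each `N ≥ 2` there exists a quantum circuit `Q_N` of depth `d = O(1)` which deterministically
  solves size-`N` instances of the 2D Hidden Linear Function problem." Here: an oracle-free
  circuit over the tree's Clifford+`T` gate set `{H, S, T, CNOT}` of depth `≤ 98` on the
  `inLen N` input wires plus `m = N²` data wires whose output distribution on `|encodeHLF I⟩|0^m⟩`
  is supported on `hlfSolutions I` for every valid instance `I` (all `N`, not only `N ≥ 2`).

The Born rule for the tree's `outputPMF` enters through the landed discharges
`Literature.Computability.Cryptography.QCircuit.outputPMF_apply_holds` (`QuantumCircuitProofs`) and
`Literature.Computability.Cryptography.cliffordT_isUnitary_holds` (`QubitRegisterCliffordTProofs`); the placed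
Clifford+`T` gates `hOn`, `sOn`, `tOn`, `cnotOn`, their basis actions, the phase bookkeeping
`ActsAs` and the exact `CCZ` word `cczWord` / `cczWord_mulVec_basisState` come from
`BQPProofs` and `ReversibleCliffordT`. The auxiliary constructions of this file live in the
namespace `Literature.QuantumAdvantage.BGK`.

## The printed proof and its rendering

BGK §3 (arXiv pp. 5–6). The circuit of Fig. 1 is `H^{⊗n} · U_q · H^{⊗n}` on the data register
`|0^n⟩`, `n = N²`, where `U_q = S(b) CZ(A)` is controlled by the classical input registers and
satisfies `U_q|x⟩ = i^{q(x)}|x⟩` (Eq. (7)); the output distribution is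
`p(z) = |⟨z|H^{⊗n} U_q H^{⊗n}|0^n⟩|²` (Eq. (8)). Lemma 2: `p(z) > 0` iff `z` is a solution;
its proof writes `p(z) = 4^{-n}|Γ(𝔽₂ⁿ, z)|²` with `Γ(L, z) = Σ_{x ∈ L} (-1)^{zᵀx} i^{q(x)}`.
Proof of Theorem 1: controlled-`S(b)` is a layer of `CS` gates on disjoint pairs, controlled
`CZ(A) = ∏_{edges} CCZ` (Eq. (9)); the grid edges split into four matchings `E₁ ∪ ⋯ ∪ E₄`, so
this is a depth-4 `CCZ` circuit; `CS` and `CCZ` are exact over Clifford+`T` [AMMR13].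

Rendering in the tree's model (`QCircuit`, `placeGate`, ASAP `depth`, `outputPMF`); everything
except the final theorem lives in the namespace `Literature.QuantumAdvantage.BGK`:

* *Gadgets*: the controlled-`S` block `csBlock` (`T_c T_t CX T†_t CX`, `T† = S³T`) with its
  exact diagonal action `csBlock_mulVec` (`i^{x_c x_t}`, via `ActsAs`), and the landed `CCZ`
  word `cczWord` (`(-1)^{x_a x_b x_c}`, `cczWord_mulVec_basisState`). (The paper's
  `S = diag(1,-i)` footnote is immaterial: the blocks are built from the tree's `S = diag(1, i)`
  and realise the phase `i^{q(x)}` directly.)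
* *Depth* (`QCircuit.depth_stagesGates_le`): a circuit given as stages of blocks on pairwise
  disjoint wire sets, of lengths `≤ L₁, …, ≤ L_s`, has ASAP depth `≤ Σ Lᵢ`; the BGK circuit has
  stages `H (1)`, four `CCZ` stages (horizontal/vertical edges of even/odd column, `22` each),
  `CS (8)`, `H (1)`: depth `≤ 98` (`hlfCircuit_depth_le`).
* *Semantics*: a Hadamard layer in closed form (`hLayerMatrix`, `QCircuit.toMatrix_hLayer`), the
  split `|e⟩ ⊗ f` of the register into input and data wires (`tens`,
  `hLayerMatrix_dataWires_mulVec_tens`, `diagonal_mulVec_tens`), the middle part as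
  `diagonal midPhase` (`midGates_mat`) and `midPhase = i^{q(x)}` on `|encodeHLF I⟩|x⟩`
  (`midPhase_append_encode`, Eq. (7)), using the enumeration of the ordered grid edges by
  `hEdge ⊔ vEdge` (`prod_prod_eq_prod_hEdge_mul_prod_vEdge`); whence the amplitude formula
  `⟨e, z|Q_N|e, 0^n⟩ = 2^{-n} Γ(z|_data)` (`hlfCircuit_amplitude_encode`, Eq. (8)/(10)).
* *Lemma 2 (⇒)* (`mem_hlfSolutions_of_gamma_ne_zero`): for `y ∈ L_q` the substitution
  `x ↦ x ⊕ y` gives `Γ(z) = (-1)^{zᵀy} i^{q(y)} Γ(z)`, so `Γ(z) ≠ 0` forces `i^{q(y)} = (-1)^{zᵀy}`,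
  i.e. `q(y) = 2 zᵀy` in `ℤ₄` (`iota_injective`).
* *Assembly*: `PMF.toOuterMeasure_apply_eq_one_iff` (probability `1` iff support ⊆ event) and
  the Born rule without normalisation (`QCircuit.outputPMF_apply_holds` for the unitary gate set
  `cliffordT`).

## References

* S. Bravyi, D. Gosset, R. König, *Quantum advantage with shallow circuits*, Science 362 (2018)
  308–311, arXiv:1704.00690: §3 (pp. 5–6 of the arXiv version), Eq. (1), (6)–(10), Fig. 1,
  Lemma 2, Theorem 1 and its proof. [cite: BravyiGossetKonigScience2018, Theorem 1]
* M. Amy, D. Maslov, M. Mosca, M. Roetteler, *A meet-in-the-middle algorithm for fast synthesis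
  of depth-optimal quantum circuits*, IEEE TCAD 32 (2013) 818–830, arXiv:1206.0758: p. 13
  (controlled-`P` over Clifford+`T` with cost `[0,0,2,3]`; Toffoli with seven `T` gates,
  `T`-depth 3) — BGK's reference [amy2013meet]. [cite: AmyEtAl2013, p. 13]
* M. A. Nielsen, I. L. Chuang, *Quantum Computation and Quantum Information* (2010), §1.4.4
  eq. (1.50) (`H^{⊗n}`), §4.2–4.3 (gates, controlled operations). [cite: NielsenChuang2010, §4.3]
-/

open Matrix

namespace Literature.Computability.QuantumComplexity.BGK

open Cryptography

variable {n : ℕ}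

/-! ### Operators determined by their action on basis states -/

/-- An operator that multiplies every basis state `|x⟩` by a scalar `d x` is the diagonal operator
`diagonal d` (a matrix is determined by its action on the computational basis). [folklore] -/
theorem eq_diagonal_of_mulVec_basisState {M : Matrix (QReg n) (QReg n) ℂ} {d : QReg n → ℂ}
    (h : ∀ x, M *ᵥ basisState x = d x • basisState x) : M = Matrix.diagonal d := by
  ext y x
  have hx := congrFun (h x) y
  rw [basisState, mulVec_single_one, col_apply] at hx
  rw [hx, diagonal_apply, Pi.smul_apply, Pi.single_apply, smul_eq_mul, mul_ite, mul_one, mul_zero]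
  by_cases hyx : y = x
  · subst hyx; simp
  · rw [if_neg hyx, if_neg hyx]


/-! ### The controlled-`S` block over Clifford+`T` -/

section gates

variable {W : ℕ}

/-- The controlled-`S` block on control `c`, target `t`: `T_c T_t CNOT_{ct} T†_t CNOT_{ct}` with `T†
= S³T` (controlled-`P` over Clifford+`T`), a word over the placed gates `tOn`, `sOn`, `cnotOn`.
[cite: AmyEtAl2013, p. 13 (controlled-P, cost [0,0,2,3])] -/
def csBlock (c t : Fin W) (h : c ≠ t) : List (QGate cliffordT W) :=
  [tOn c, tOn t, cnotOn c t h, sOn t, sOn t, sOn t, tOn t, cnotOn c t h]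

/-- The eigenvalue `i^{ab}` of controlled-`S` on `|a, b⟩`. [folklore] -/
noncomputable def csPhase (a b : Bool) : ℂ := if (a && b) then Complex.I else 1

/-- **The controlled-`S` block is exact:** `csBlock c t` maps `|x⟩` to `i^{x_c x_t} |x⟩` (in the
`ActsAs` calculus: trivial permutation, phase exponent `x_c + x_t + 7 (x_c ⊕ x_t) ≡ 2 x_c x_t
(mod 8)`; controlled-`P` over Clifford+`T` with two `CNOT`s and three `T`-type gates).
[cite: AmyEtAl2013, p. 13 (controlled-P, cost [0,0,2,3])] -/
theorem csBlock_mulVec (A : Language Bool) (c t : Fin W) (h : c ≠ t) (x : QReg W) :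
    (⟨csBlock c t h⟩ : QCircuit cliffordT W).toMatrix A *ᵥ basisState x =
      csPhase (x c) (x t) • basisState x := by
  have H : ActsAs ((⟨csBlock c t h⟩ : QCircuit cliffordT W).toMatrix A) _ _ :=
    (actsAs_tOn A c).cons <| (actsAs_tOn A t).cons <| (actsAs_cnotOn A c t h).cons <|
    (actsAs_sOn A t).cons <| (actsAs_sOn A t).cons <| (actsAs_sOn A t).cons <|
      (actsAs_tOn A t).cons <| (actsAs_cnotOn A c t h).cons <| actsAs_nil A
  have hy : Function.update x t (x t ^^ x c) c = x c := Function.update_of_ne h _ _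
  rw [H x, ← omega_pow_mod_eight]
  congr 1
  · simp only [id_eq, Function.update_self]
    rcases Bool.eq_false_or_eq_true (x c) with hc | hc <;>
    rcases Bool.eq_false_or_eq_true (x t) with ht | ht <;>
    simp [hc, ht, csPhase, omega_pow_two]
  · congr 1
    simp only [Function.comp_apply, id_eq, Function.update_self, hy, Function.update_idem]
    rw [Bool.xor_assoc, Bool.xor_self, Bool.xor_false, Function.update_eq_self]

end gates

namespace QCircuit

open Cryptography.QCircuit

variable {G : QGateSet} {n : ℕ}

/-! ### Depth of layered circuits -/

/-- ASAP layering of a concatenation: layer the first list, then continue with the second.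
[folklore] -/
theorem depthAux_append (l₁ l₂ : List (QGate G n)) (d : Fin n → ℕ) :
    depthAux (l₁ ++ l₂) d = depthAux l₂ (depthAux l₁ d) := by
  induction l₁ generalizing d with
  | nil => rfl
  | cons g gs ih => exact ih _

/-- The set of wires touched by a block (list) of gates. [folklore] -/
def blockWires (b : List (QGate G n)) : Finset (Fin n) := b.foldr (fun g s => g.wires ∪ s) ∅

/-- The empty block touches no wire. [folklore] -/
@[simp] theorem blockWires_nil : blockWires ([] : List (QGate G n)) = ∅ := rfl

/-- Wires of `g :: gs`. [folklore] -/
@[simp] theorem blockWires_cons (g : QGate G n) (gs : List (QGate G n)) :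
    blockWires (g :: gs) = g.wires ∪ blockWires gs := rfl

/-- A wire is touched by a block iff some gate of the block acts on it. [folklore] -/
theorem mem_blockWires {b : List (QGate G n)} {i : Fin n} :
    i ∈ blockWires b ↔ ∃ g ∈ b, i ∈ g.wires := by
  induction b with
  | nil => simp
  | cons g gs ih => simp [Finset.mem_union, ih]

/-- Processing one block raises the layers of its own wires by at most its length and leaves the
other wires unchanged. [folklore] -/
theorem depthAux_block (b : List (QGate G n)) (d : Fin n → ℕ) (M : ℕ)
    (hd : ∀ i ∈ blockWires b, d i ≤ M) :
    (∀ i ∈ blockWires b, depthAux b d i ≤ M + b.length) ∧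
      (∀ i ∉ blockWires b, depthAux b d i = d i) := by
  induction b generalizing d M with
  | nil => simp [depthAux]
  | cons g gs ih =>
    set d' : Fin n → ℕ := fun i => if i ∈ g.wires then g.wires.sup d + 1 else d i with hd'
    have hsup : g.wires.sup d ≤ M :=
      Finset.sup_le fun i hi => hd i (by simp [hi])
    have hd'le : ∀ i ∈ blockWires (g :: gs), d' i ≤ M + 1 := by
      intro i hi
      simp only [hd']
      split_ifs with hig
      · omega
      · exact (hd i hi).trans (Nat.le_succ M)
    obtain ⟨h1, h2⟩ := ih d' (M + 1) fun i hi => hd'le i (by simp [hi])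
    refine ⟨fun i hi => ?_, fun i hi => ?_⟩
    · show depthAux gs d' i ≤ M + (gs.length + 1)
      by_cases hi' : i ∈ blockWires gs
      · have := h1 i hi'
        omega
      · rw [h2 i hi']
        have := hd'le i hi
        omega
    · show depthAux gs d' i = d i
      have hig : i ∉ g.wires := fun h => hi (by simp [h])
      have hi' : i ∉ blockWires gs := fun h => hi (by simp [h])
      rw [h2 i hi', hd']
      simp [hig]

/-- A *stage* of width `L`: a list of blocks of length at most `L` acting on pairwise disjoint sets
of wires (BGK: gates of one layer act on disjoint qubits). [folklore] -/
def IsStage (L : ℕ) (B : List (List (QGate G n))) : Prop :=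
  (∀ b ∈ B, b.length ≤ L) ∧ B.Pairwise fun b b' => Disjoint (blockWires b) (blockWires b')

/-- Auxiliary form of `depthAux_stage` with an invariant on the wires not yet processed. [folklore]
-/
theorem depthAux_stage_aux (B : List (List (QGate G n))) (L M : ℕ)
    (hlen : ∀ b ∈ B, b.length ≤ L)
    (hdisj : B.Pairwise fun b b' => Disjoint (blockWires b) (blockWires b'))
    (d : Fin n → ℕ) (hd : ∀ i, d i ≤ M + L) (hd' : ∀ b ∈ B, ∀ i ∈ blockWires b, d i ≤ M) :
    ∀ i, depthAux B.flatten d i ≤ M + L := by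
  induction B generalizing d with
  | nil => simpa [depthAux] using hd
  | cons b bs ih =>
    rw [List.flatten_cons, depthAux_append]
    obtain ⟨h1, h2⟩ := depthAux_block b d M (hd' b (by simp))
    rw [List.pairwise_cons] at hdisj
    refine ih (fun b' hb' => hlen b' (by simp [hb'])) hdisj.2 _ (fun i => ?_)
      (fun b' hb' i hi => ?_)
    · by_cases hi : i ∈ blockWires b
      · exact (h1 i hi).trans (by have := hlen b (by simp); omega)
      · rw [h2 i hi]
        exact hd i
    · have hib : i ∉ blockWires b := fun h => Finset.disjoint_left.1 (hdisj.1 b' hb') h hi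
      rw [h2 i hib]
      exact hd' b' (by simp [hb']) i hi

/-- Processing a stage of width `L` raises the maximal wire layer by at most `L`. [folklore] -/
theorem depthAux_stage {L : ℕ} {B : List (List (QGate G n))} (hB : IsStage L B) {M : ℕ}
    {d : Fin n → ℕ} (hd : ∀ i, d i ≤ M) : ∀ i, depthAux B.flatten d i ≤ M + L :=
  depthAux_stage_aux B L M hB.1 hB.2 d (fun i => (hd i).trans (Nat.le_add_right M L))
    fun _ _ i _ => hd i

/-- The gate list of a sequence of stages. [folklore] -/
def stagesGates (Ss : List (ℕ × List (List (QGate G n)))) : List (QGate G n) :=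
  (Ss.map fun p => p.2.flatten).flatten

/-- Processing stages of widths `L₁, …, L_s` raises the maximal wire layer by at most `L₁ + ⋯ +
L_s`. [folklore] -/
theorem depthAux_stagesGates (Ss : List (ℕ × List (List (QGate G n))))
    (h : ∀ p ∈ Ss, IsStage p.1 p.2) {M : ℕ} {d : Fin n → ℕ} (hd : ∀ i, d i ≤ M) :
    ∀ i, depthAux (stagesGates Ss) d i ≤ M + (Ss.map Prod.fst).sum := by
  induction Ss generalizing M d with
  | nil => simpa [stagesGates, depthAux] using hd
  | cons p ps ih =>
    intro i
    rw [stagesGates, List.map_cons, List.flatten_cons, depthAux_append, List.map_cons,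
      List.sum_cons, ← add_assoc]
    exact ih (fun q hq => h q (by simp [hq])) (depthAux_stage (h p (by simp)) hd) i

/-- **Depth of a layered circuit.** A circuit presented as a sequence of stages of widths `L₁, …,
L_s` has depth at most `L₁ + ⋯ + L_s` (the depth count used in BGK's proof of Theorem 1: a depth-4
`CCZ` circuit etc.). [cite: BravyiGossetKonigScience2018, proof of Theorem 1, p. 6] -/
theorem depth_stagesGates_le (Ss : List (ℕ × List (List (QGate G n))))
    (h : ∀ p ∈ Ss, IsStage p.1 p.2) :
    (⟨stagesGates Ss⟩ : QCircuit G n).depth ≤ (Ss.map Prod.fst).sum := by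
  refine Finset.sup_le fun i _ => ?_
  simpa using depthAux_stagesGates Ss h (M := 0) (d := fun _ => 0) (fun _ => le_rfl) i

/-- A stage all of whose blocks come from an indexed family with pairwise disjoint wire sets.
[folklore] -/
theorem isStage_map {ι : Type*} (L : ℕ) (f : ι → List (QGate G n)) (l : List ι) (hl : l.Nodup)
    (hlen : ∀ a ∈ l, (f a).length ≤ L)
    (hdisj : ∀ a ∈ l, ∀ a' ∈ l, a ≠ a' → Disjoint (blockWires (f a)) (blockWires (f a'))) :
    IsStage L (l.map f) := by
  refine ⟨fun b hb => ?_, ?_⟩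
  · obtain ⟨a, ha, rfl⟩ := List.mem_map.1 hb
    exact hlen a ha
  · rw [List.pairwise_map]
    exact hl.pairwise_of_forall_ne hdisj

end QCircuit

/-! ### A layer of Hadamard gates in closed form -/

section hLayer

variable {W : ℕ}

/-- Entries of the Hadamard gate as a function of the two bits: `⟨a|H|b⟩ = (-1)^{ab}/√2`.
(Nielsen–Chuang §1.3.1.) [cite: NielsenChuang2010, §4.2] -/
noncomputable def hCoef (a b : Bool) : ℂ := if a = true ∧ b = true then -invSqrt2 else invSqrt2

/-- Entries of the Hadamard gate (definitional). [cite: NielsenChuang2010, §4.2] -/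
theorem hGate_apply (x y : QReg 1) : hGate x y = hCoef (x 0) (y 0) := rfl

/-- The Hadamard matrix is symmetric. [cite: NielsenChuang2010, §4.2] -/
theorem hCoef_comm (a b : Bool) : hCoef a b = hCoef b a := by
  cases a <;> cases b <;> simp [hCoef]

/-- Hadamard gates on the wires of `S`, in closed form: the `(x, y)` entry is `∏_{i ∈ S}
⟨x_i|H|y_i⟩` if `x, y` agree off `S`, else `0` (the tensor power `H^{⊗ S} ⊗ 1`). (Nielsen–Chuang
§1.4.4, §4.2.) [cite: NielsenChuang2010, §1.4.4] -/
noncomputable def hLayerMatrix (S : Finset (Fin W)) : Matrix (QReg W) (QReg W) ℂ :=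
  Matrix.of fun x y => if (∀ i, i ∉ S → x i = y i) then ∏ i ∈ S, hCoef (x i) (y i) else 0

/-- Entries of a Hadamard layer (definitional). [folklore] -/
theorem hLayerMatrix_apply (S : Finset (Fin W)) (x y : QReg W) :
    hLayerMatrix S x y =
      if (∀ i, i ∉ S → x i = y i) then ∏ i ∈ S, hCoef (x i) (y i) else 0 := rfl

/-- The Hadamard layer on no wires is the identity. [folklore] -/
theorem hLayerMatrix_empty : hLayerMatrix (∅ : Finset (Fin W)) = 1 := by
  ext x y
  rw [hLayerMatrix_apply, Matrix.one_apply, Finset.prod_empty]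
  simp only [Finset.notMem_empty, not_false_eq_true, forall_const]
  by_cases h : x = y
  · simp [h]
  · rw [if_neg (fun h' => h (funext h')), if_neg h]

/-- Entries of a single placed Hadamard gate. [cite: NielsenChuang2010, §4.2] -/
theorem placeGate_wireEmb_hGate_apply (w : Fin W) (x y : QReg W) :
    placeGate (wireEmb w) hGate x y = if (∀ i, i ≠ w → x i = y i) then hCoef (x w) (y w) else 0 := by
  rw [placeGate_apply, hGate_apply]
  have hr : ∀ i : Fin W, i ∉ Set.range (wireEmb w) ↔ i ≠ w := fun i => by simp
  simp only [hr, Function.comp_apply, wireEmb_apply]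

/-- Adding one more Hadamard gate to a layer: `hLayerMatrix S · H_w = hLayerMatrix (insert w S)`
for `w ∉ S`. [folklore] -/
theorem hLayerMatrix_mul_placeGate_hGate (S : Finset (Fin W)) (w : Fin W) (hw : w ∉ S) :
    hLayerMatrix S * placeGate (wireEmb w) hGate = hLayerMatrix (insert w S) := by
  ext x z
  rw [Matrix.mul_apply, hLayerMatrix_apply]
  -- the unique contributing intermediate label
  set y₀ : QReg W := Function.update z w (x w) with hy₀
  have hy₀w : y₀ w = x w := Function.update_self _ _ _
  have hy₀off : ∀ i, i ≠ w → y₀ i = z i := fun i hi => Function.update_of_ne hi _ _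
  rw [Finset.sum_eq_single y₀]
  · rw [hLayerMatrix_apply, placeGate_wireEmb_hGate_apply, if_pos fun i hi => hy₀off i hi, hy₀w]
    by_cases hc : ∀ i, i ∉ insert w S → x i = z i
    · rw [if_pos hc, if_pos, Finset.prod_insert hw, mul_comm]
      · congr 1
        exact Finset.prod_congr rfl fun i hi => by rw [hy₀off i (fun h => hw (h ▸ hi))]
      · intro i hi
        by_cases hiw : i = w
        · rw [hiw, hy₀w]
        · rw [hy₀off i hiw]
          exact hc i (by simp [hiw, hi])
    · rw [if_neg hc, if_neg, zero_mul]
      intro h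
      apply hc
      intro i hi
      rw [Finset.mem_insert, not_or] at hi
      rw [h i hi.2, hy₀off i hi.1]
  · intro y _ hy
    rw [hLayerMatrix_apply, placeGate_wireEmb_hGate_apply]
    split_ifs with h1 h2
    · exfalso
      apply hy
      funext i
      by_cases hiw : i = w
      · rw [hiw, hy₀w, h1 w hw]
      · rw [hy₀off i hiw, h2 i hiw]
    · exact mul_zero _
    · exact zero_mul _
    · exact zero_mul _
  · intro h
    exact absurd (Finset.mem_univ _) h

end hLayer

/-! ### Splitting a register into input wires and data wires -/

section split

variable {L n : ℕ}

/-- The state `|e⟩ ⊗ f` on `L + n` wires: the first `L` (input) wires hold the basis label `e`, the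
last `n` (data) wires carry the coefficient vector `f`. (Nielsen–Chuang §2.1.7.) [folklore] -/
noncomputable def tens (e : QReg L) (f : QReg n → ℂ) : QReg (L + n) → ℂ :=
  fun y => if (fun i => y (Fin.castAdd n i)) = e then f (fun j => y (Fin.natAdd L j)) else 0

/-- Amplitudes of `|e⟩ ⊗ f` (definitional). [folklore] -/
theorem tens_apply (e : QReg L) (f : QReg n → ℂ) (y : QReg (L + n)) :
    tens e f y =
      if (fun i => y (Fin.castAdd n i)) = e then f (fun j => y (Fin.natAdd L j)) else 0 := rfl

/-- Amplitude of `|e⟩ ⊗ f` at the register `(e', x)`: `[e' = e] · f x`. [folklore] -/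
theorem tens_append (e e' : QReg L) (f : QReg n → ℂ) (x : QReg n) :
    tens e f (Fin.append e' x) = if e' = e then f x else 0 := by
  simp only [tens_apply, Fin.append_left, Fin.append_right]

/-- Summing over a register = summing over its input part and its data part. [folklore] -/
theorem sum_split (F : QReg (L + n) → ℂ) :
    ∑ y, F y = ∑ e : QReg L, ∑ x : QReg n, F (Fin.append e x) := by
  rw [← Equiv.sum_comp (Fin.appendEquiv L n), Fintype.sum_prod_type]
  rfl

/-- `|e 0^n⟩ = |e⟩ ⊗ |0^n⟩`. (Nielsen–Chuang §4.5, ancillas.) [folklore] -/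
theorem basisState_padInput (e : QReg L) :
    basisState (padInput e n) = tens e (basisState fun _ => false) := by
  ext y
  rw [basisState_apply, tens_apply, basisState_apply, padInput]
  by_cases h1 : (fun i => y (Fin.castAdd n i)) = e
  · rw [if_pos h1]
    by_cases h2 : (fun j => y (Fin.natAdd L j)) = fun _ => false
    · rw [if_pos h2, if_pos]
      rw [← h1, ← h2]
      exact Fin.append_castAdd_natAdd.symm
    · rw [if_neg h2, if_neg]
      intro hy
      apply h2
      subst hy
      funext j
      exact Fin.append_right _ _ j
  · rw [if_neg h1, if_neg]
    intro hy
    apply h1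
    subst hy
    funext i
    exact Fin.append_left _ _ i

/-- The data wires, as a `Finset`. [folklore] -/
def dataWires (L n : ℕ) : Finset (Fin (L + n)) :=
  Finset.univ.map ⟨Fin.natAdd L, Fin.natAdd_injective n L⟩

/-- Membership in the data wires. [folklore] -/
theorem mem_dataWires_iff {i : Fin (L + n)} : i ∈ dataWires L n ↔ ∃ j, Fin.natAdd L j = i := by
  simp [dataWires]

/-- Input wires are not data wires. [folklore] -/
theorem castAdd_not_mem_dataWires (i : Fin L) : Fin.castAdd n i ∉ dataWires L n := by
  rw [mem_dataWires_iff]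
  rintro ⟨j, hj⟩
  have := congrArg Fin.val hj
  simp at this
  omega

/-- Data wires are data wires. [folklore] -/
theorem natAdd_mem_dataWires (j : Fin n) : Fin.natAdd L j ∈ dataWires L n :=
  mem_dataWires_iff.2 ⟨j, rfl⟩

/-- Agreement off the data wires is agreement on the input wires. [folklore] -/
theorem forall_not_mem_dataWires_iff {z y : QReg (L + n)} :
    (∀ i, i ∉ dataWires L n → z i = y i) ↔
      (fun i => z (Fin.castAdd n i)) = fun i => y (Fin.castAdd n i) := by
  constructor
  · intro h
    funext i
    exact h _ (castAdd_not_mem_dataWires i)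
  · intro h i hi
    induction i using Fin.addCases with
    | left i => exact congrFun h i
    | right j => exact absurd (natAdd_mem_dataWires j) hi

/-- A product over the data wires, reindexed by data index. [folklore] -/
theorem prod_dataWires (g : Fin (L + n) → ℂ) :
    ∏ i ∈ dataWires L n, g i = ∏ j : Fin n, g (Fin.natAdd L j) := by
  rw [dataWires, Finset.prod_map]
  rfl

/-- The `n`-qubit Hadamard transform in coefficients, `(H^{⊗ n} f)(x') = Σ_x ∏_j ⟨x'_j|H|x_j⟩ f(x)`.
(Nielsen–Chuang §1.4.4.) [cite: NielsenChuang2010, §1.4.4] -/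
noncomputable def hadT (f : QReg n → ℂ) : QReg n → ℂ :=
  fun x' => ∑ x, (∏ j, hCoef (x' j) (x j)) * f x

/-- A layer of Hadamard gates on the data wires acts on `|e⟩ ⊗ f` as `|e⟩ ⊗ H^{⊗ n} f`. [folklore]
-/
theorem hLayerMatrix_dataWires_mulVec_tens (e : QReg L) (f : QReg n → ℂ) :
    hLayerMatrix (dataWires L n) *ᵥ tens e f = tens e (hadT f) := by
  ext z
  change ∑ y, hLayerMatrix (dataWires L n) z y * tens e f y = _
  rw [sum_split]
  simp only [hLayerMatrix_apply, tens_append, forall_not_mem_dataWires_iff, Fin.append_left, prod_dataWires,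
    Fin.append_right]
  rw [Finset.sum_eq_single e]
  · rw [tens_apply]
    by_cases hz : (fun i => z (Fin.castAdd n i)) = e
    · rw [if_pos hz, hadT]
      refine Finset.sum_congr rfl fun x _ => ?_
      rw [if_pos hz, if_pos rfl]
    · rw [if_neg hz]
      refine Finset.sum_eq_zero fun x _ => ?_
      rw [if_neg hz, zero_mul]
  · intro e' _ he'
    refine Finset.sum_eq_zero fun x _ => ?_
    rw [if_neg he', mul_zero]
  · intro h
    exact absurd (Finset.mem_univ e) h

/-- A diagonal operator acts on `|e⟩ ⊗ f` coefficientwise. [folklore] -/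
theorem diagonal_mulVec_tens (Φ : QReg (L + n) → ℂ) (e : QReg L) (f : QReg n → ℂ) :
    Matrix.diagonal Φ *ᵥ tens e f = tens e (fun x => Φ (Fin.append e x) * f x) := by
  ext y
  rw [mulVec_diagonal, tens_apply, tens_apply]
  split_ifs with h
  · subst h
    rw [Fin.append_castAdd_natAdd]
  · exact mul_zero _

/-- `⟨a|H|0⟩ = 1/√2`. [cite: NielsenChuang2010, §4.2] -/
theorem hCoef_false_right (a : Bool) : hCoef a false = invSqrt2 := by
  cases a <;> simp [hCoef]

/-- `H^{⊗ n} |0^n⟩` is the uniform superposition `2^{-n/2} Σ_x |x⟩`. (BGK, Fig. 1 / Nielsen–Chuang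
§1.4.4, eq. (1.44).) [cite: BravyiGossetKonigScience2018, §3 Fig. 1] -/
theorem hadT_basisState_zero :
    hadT (n := n) (basisState fun _ => false) = fun _ => invSqrt2 ^ n := by
  funext x'
  rw [hadT, Finset.sum_eq_single (fun _ => false : QReg n)]
  · simp [hCoef_false_right, Finset.prod_const, Finset.card_univ, Fintype.card_fin]
  · intro x _ hx
    simp [basisState_apply, hx]
  · intro h
    exact absurd (Finset.mem_univ _) h

/-- The sign `(-1)^b`. [folklore] -/
noncomputable def sgn (b : Bool) : ℂ := if b = true then -1 else 1

/-- `⟨a|H|b⟩ = (-1)^{ab} / √2`. (Nielsen–Chuang §1.4.4.) [cite: NielsenChuang2010, §4.2] -/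
theorem hCoef_eq (a b : Bool) : hCoef a b = invSqrt2 * sgn (a && b) := by
  cases a <;> cases b <;> simp [hCoef, sgn]

/-- `(H^{⊗ n} f)(x') = 2^{-n/2} Σ_x (-1)^{x'·x} f(x)`. (Nielsen–Chuang §1.4.4, eq. (1.50).)
[cite: NielsenChuang2010, §1.4.4 eq. (1.50)] -/
theorem hadT_apply (f : QReg n → ℂ) (x' : QReg n) :
    hadT f x' = invSqrt2 ^ n * ∑ x, (∏ j, sgn (x' j && x j)) * f x := by
  rw [hadT, Finset.mul_sum]
  refine Finset.sum_congr rfl fun x _ => ?_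
  simp only [hCoef_eq, Finset.prod_mul_distrib, Finset.prod_const, Finset.card_univ,
    Fintype.card_fin]
  ring

/-- `(-1)^{a(b ⊕ c)} = (-1)^{ab} (-1)^{ac}`. [folklore] -/
theorem sgn_and_xor (a b c : Bool) : sgn (a && (b ^^ c)) = sgn (a && b) * sgn (a && c) := by
  cases a <;> cases b <;> cases c <;> simp [sgn]

/-- `((-1)^b)² = 1`. [folklore] -/
theorem sgn_mul_self (b : Bool) : sgn b * sgn b = 1 := by
  cases b <;> simp [sgn]

end split

/-! ### Blocks acting diagonally; layers of Hadamard gates; wires of blocks -/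

section blockLemmas

variable {W : ℕ} {G : QGateSet}

/-- The matrix of a concatenated gate list (second list on the left). [folklore] -/
theorem QCircuit.toMatrix_append_list (A : Language Bool) (l₁ l₂ : List (QGate G W)) :
    (⟨l₁ ++ l₂⟩ : QCircuit G W).toMatrix A =
      (⟨l₂⟩ : QCircuit G W).toMatrix A * (⟨l₁⟩ : QCircuit G W).toMatrix A :=
  QCircuit.toMatrix_append A ⟨l₁⟩ ⟨l₂⟩

/-- A sequence of blocks each acting diagonally on the computational basis acts diagonally, with the
product of the phases. [folklore] -/
theorem QCircuit.toMatrix_flatten_map_mulVec_basisState {ι : Type*} (A : Language Bool)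
    (B : ι → List (QGate G W)) (φ : ι → QReg W → ℂ)
    (h : ∀ i x, (⟨B i⟩ : QCircuit G W).toMatrix A *ᵥ basisState x = φ i x • basisState x)
    (l : List ι) (x : QReg W) :
    (⟨(l.map B).flatten⟩ : QCircuit G W).toMatrix A *ᵥ basisState x =
      (l.map fun i => φ i x).prod • basisState x := by
  induction l with
  | nil => simp
  | cons i l ih =>
    rw [List.map_cons, List.flatten_cons, QCircuit.toMatrix_append_list, ← Matrix.mulVec_mulVec, h,
      Matrix.mulVec_smul, ih, smul_smul, List.map_cons, List.prod_cons]

/-- Two gate lists acting diagonally on the computational basis compose to a diagonal action with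
the product phase. [folklore] -/
theorem QCircuit.toMatrix_append_mulVec_basisState (A : Language Bool) (l₁ l₂ : List (QGate G W))
    (a b : QReg W → ℂ)
    (h₁ : ∀ x, (⟨l₁⟩ : QCircuit G W).toMatrix A *ᵥ basisState x = a x • basisState x)
    (h₂ : ∀ x, (⟨l₂⟩ : QCircuit G W).toMatrix A *ᵥ basisState x = b x • basisState x)
    (x : QReg W) :
    (⟨l₁ ++ l₂⟩ : QCircuit G W).toMatrix A *ᵥ basisState x = (a x * b x) • basisState x := by
  rw [QCircuit.toMatrix_append_list, ← Matrix.mulVec_mulVec, h₁, Matrix.mulVec_smul, h₂, smul_smul]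

/-- The matrix of a layer of Hadamard gates on distinct wires is the closed form `hLayerMatrix`.
[folklore] -/
theorem QCircuit.toMatrix_hLayer {ι : Type*} (A : Language Bool) (w : ι → Fin W) (l : List ι)
    (hl : (l.map w).Nodup) :
    (⟨(l.map fun i => [hOn (w i)]).flatten⟩ : QCircuit cliffordT W).toMatrix A =
      hLayerMatrix (l.map w).toFinset := by
  induction l with
  | nil => simp [hLayerMatrix_empty]
  | cons i l ih =>
    rw [List.map_cons, List.nodup_cons] at hl
    simp only [List.map_cons, List.flatten_cons, List.singleton_append, List.toFinset_cons]
    rw [QCircuit.toMatrix_cons, ih hl.2]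
    have hw : w i ∉ (l.map w).toFinset := fun h => hl.1 (List.mem_toFinset.1 h)
    exact hLayerMatrix_mul_placeGate_hGate _ _ hw

/-- A staged circuit all of whose gates are gate symbols is oracle-free. [folklore] -/
theorem QCircuit.isOracleFree_stagesGates (Ss : List (ℕ × List (List (QGate G W))))
    (h : ∀ p ∈ Ss, ∀ b ∈ p.2, ∀ g ∈ b, g.IsOracleFree) :
    (⟨QCircuit.stagesGates Ss⟩ : QCircuit G W).IsOracleFree := by
  intro g hg
  simp only [QCircuit.stagesGates, List.mem_flatten, List.mem_map] at hg
  obtain ⟨l, ⟨p, hp, rfl⟩, hg⟩ := hg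
  rw [List.mem_flatten] at hg
  obtain ⟨b, hb, hgb⟩ := hg
  exact h p hp b hb g hgb

/-- `H_w` acts on the wire `w` only. [folklore] -/
theorem mem_wires_hOn {i w : Fin W} : i ∈ (hOn w).wires ↔ i = w := by
  show i ∈ (Finset.univ : Finset (Fin 1)).map (wireEmb w) ↔ _
  simp

/-- `S_w` acts on the wire `w` only. [folklore] -/
theorem mem_wires_sOn {i w : Fin W} : i ∈ (sOn w).wires ↔ i = w := by
  show i ∈ (Finset.univ : Finset (Fin 1)).map (wireEmb w) ↔ _
  simp

/-- `T_w` acts on the wire `w` only. [folklore] -/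
theorem mem_wires_tOn {i w : Fin W} : i ∈ (tOn w).wires ↔ i = w := by
  show i ∈ (Finset.univ : Finset (Fin 1)).map (wireEmb w) ↔ _
  simp

/-- `CNOT_{c,t}` acts on the wires `c, t` only. [folklore] -/
theorem mem_wires_cnotOn {i c t : Fin W} (h : c ≠ t) :
    i ∈ (cnotOn c t h).wires ↔ i = c ∨ i = t := by
  show i ∈ (Finset.univ : Finset (Fin 2)).map (pairEmb c t h) ↔ _
  simp [Fin.exists_fin_two, eq_comm]

/-- The block `[H_w]` touches exactly `w`. [folklore] -/
theorem blockWires_hBlock (w : Fin W) : QCircuit.blockWires [hOn w] = {w} := by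
  ext i
  simp [mem_wires_hOn]

/-- The controlled-`S` block touches only its two wires. [folklore] -/
theorem mem_blockWires_csBlock {i c t : Fin W} {h : c ≠ t}
    (hi : i ∈ QCircuit.blockWires (csBlock c t h)) : i = c ∨ i = t := by
  simp only [csBlock, QCircuit.blockWires_cons, QCircuit.blockWires_nil, Finset.mem_union,
    mem_wires_tOn, mem_wires_sOn, mem_wires_cnotOn, Finset.notMem_empty, or_false] at hi
  tauto

/-- The `CCZ` word touches only its three wires. [folklore] -/
theorem mem_blockWires_cczWord {i a b c : Fin W} {hab : a ≠ b} {hac : a ≠ c} {hbc : b ≠ c}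
    (hi : i ∈ QCircuit.blockWires (cczWord a b c hab hac hbc)) : i = a ∨ i = b ∨ i = c := by
  simp only [cczWord, QCircuit.blockWires_cons, QCircuit.blockWires_nil, Finset.mem_union,
    mem_wires_tOn, mem_wires_sOn, mem_wires_cnotOn, Finset.notMem_empty, or_false] at hi
  tauto

/-- The gates of `[H_w]` are gate symbols. [folklore] -/
theorem isOracleFree_of_mem_hBlock {w : Fin W} {g : QGate cliffordT W} (hg : g ∈ [hOn w]) :
    g.IsOracleFree := by
  simp only [List.mem_singleton] at hg
  subst hg
  trivial

/-- The gates of the controlled-`S` block are gate symbols. [folklore] -/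
theorem isOracleFree_of_mem_csBlock {c t : Fin W} {h : c ≠ t} {g : QGate cliffordT W}
    (hg : g ∈ csBlock c t h) : g.IsOracleFree := by
  simp only [csBlock, List.mem_cons, List.mem_nil_iff, or_false] at hg
  rcases hg with rfl | rfl | rfl | rfl | rfl | rfl | rfl | rfl <;> trivial


end blockLemmas

/-! ### The character `a ↦ i^a` of `ℤ₄` and BGK Lemma 2 (⇒) -/

/-- `ι a = i^a`, the standard character of `ℤ₄` (BGK: `U_q|x⟩ = i^{q(x)}|x⟩`, arithmetic in `ℤ₄`).
[cite: BravyiGossetKonigScience2018, §3 Eq. (7)] -/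
noncomputable def iota (a : ZMod 4) : ℂ := Complex.I ^ a.val

/-- `i^{m mod 4} = i^m`. [folklore] -/
theorem I_pow_mod_four (m : ℕ) : Complex.I ^ (m % 4) = Complex.I ^ m := by
  conv_rhs => rw [← Nat.mod_add_div m 4, pow_add, pow_mul, Complex.I_pow_four, one_pow, mul_one]

/-- `i^{a+b} = i^a i^b` on `ℤ₄`. [folklore] -/
theorem iota_add (a b : ZMod 4) : iota (a + b) = iota a * iota b := by
  rw [iota, ZMod.val_add, I_pow_mod_four, pow_add]
  rfl

/-- `i^0 = 1`. [folklore] -/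
theorem iota_zero : iota 0 = 1 := by
  simp [iota]

/-- `i^2 = -1`. [folklore] -/
theorem iota_two : iota 2 = -1 := by
  rw [iota, show (2 : ZMod 4).val = 2 from rfl, Complex.I_sq]

/-- `i^{Σ aⱼ} = ∏ i^{aⱼ}` on `ℤ₄`. [folklore] -/
theorem iota_sum {α : Type*} (s : Finset α) (f : α → ZMod 4) :
    iota (∑ i ∈ s, f i) = ∏ i ∈ s, iota (f i) := by
  induction s using Finset.cons_induction with
  | empty => simp [iota_zero]
  | cons a s ha ih => rw [Finset.sum_cons, Finset.prod_cons, iota_add, ih]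

/-- `a ↦ i^a` is injective on `ℤ₄` (`i` has order `4`). [folklore] -/
theorem iota_injective : Function.Injective iota := by
  intro a b h
  have ha := ZMod.val_lt a
  have hb := ZMod.val_lt b
  apply ZMod.val_injective
  unfold iota at h
  have h2 : Complex.I ^ 2 = -1 := Complex.I_sq
  have h3 : Complex.I ^ 3 = -Complex.I := by rw [pow_succ, h2]; ring
  generalize a.val = i at h ha
  generalize b.val = j at h hb
  interval_cases i <;> interval_cases j <;> simp only [pow_zero, pow_one, h2, h3] at h <;>
    first
    | rfl
    | (exfalso
       have hre := congrArg Complex.re h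
       norm_num at hre
       done)
    | (exfalso
       have him := congrArg Complex.im h
       norm_num at him)

variable {N : ℕ}

/-- The Fourier amplitude `Γ(𝔽₂ⁿ, z) = Σ_x (-1)^{zᵀx} i^{q(x)}` of BGK, proof of Lemma 2 (p. 5):
`p(z) = 4^{-n} |Γ(𝔽₂ⁿ, z)|²`. [cite: BravyiGossetKonigScience2018, §3 Lemma 2 (proof)] -/
noncomputable def gamma (I : HLFInstance N) (z : Fin N × Fin N → Bool) : ℂ :=
  ∑ x : Fin N × Fin N → Bool, (∏ v, sgn (z v && x v)) * iota (I.q x)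

/-- The shift argument: for `y ∈ L_q`, substituting `x ↦ x ⊕ y` gives `Γ(z) = (-1)^{zᵀy} i^{q(y)}
Γ(z)` (BGK write `Γ(𝔽₂ⁿ, z) = Σ_{x ∈ K} (-1)^{zᵀx} i^{q(x)} Γ(L_q, z)` with `Γ(L_q, z) = Σ_{y ∈ L_q}
(-1)^{zᵀy} i^{q(y)}`). [cite: BravyiGossetKonigScience2018, §3 Lemma 2 (proof)] -/
theorem gamma_shift (I : HLFInstance N) (z y : Fin N × Fin N → Bool) (hy : y ∈ I.Lq) :
    gamma I z = ((∏ v, sgn (z v && y v)) * iota (I.q y)) * gamma I z := by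
  unfold gamma
  rw [Finset.mul_sum, ← Equiv.sum_comp (Equiv.addRight y)]
  refine Finset.sum_congr rfl fun x _ => ?_
  have hq : I.q (x + y) = I.q x + I.q y := by rw [add_comm x y, hy x, add_comm]
  simp only [Equiv.coe_addRight, hq, iota_add]
  have hs : (∏ v, sgn (z v && (x + y) v)) = (∏ v, sgn (z v && x v)) * ∏ v, sgn (z v && y v) := by
    rw [← Finset.prod_mul_distrib]
    exact Finset.prod_congr rfl fun v _ => sgn_and_xor (z v) (x v) (y v)
  rw [hs]
  ring

/-- **BGK Lemma 2 (⇒).** If the amplitude `Γ(z)` is nonzero then `z` is a solution: `q(y) = 2 zᵀy`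
for all `y ∈ L_q` ("`p(z) > 0` iff `z` is a solution of the Hidden Linear Function problem"; only
this direction is needed for Theorem 1). [cite: BravyiGossetKonigScience2018, §3 Lemma 2] -/
theorem mem_hlfSolutions_of_gamma_ne_zero (I : HLFInstance N) (z : Fin N × Fin N → Bool)
    (hz : gamma I z ≠ 0) : z ∈ hlfSolutions I := by
  intro y hy
  have h1 := gamma_shift I z y hy
  have hK : (∏ v, sgn (z v && y v)) * iota (I.q y) = 1 :=
    mul_right_cancel₀ hz (h1.symm.trans (one_mul _).symm)
  have hss : (∏ v, sgn (z v && y v)) * ∏ v, sgn (z v && y v) = 1 := by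
    rw [← Finset.prod_mul_distrib]
    exact Finset.prod_eq_one fun v _ => sgn_mul_self _
  have h2 : iota (I.q y) = ∏ v, sgn (z v && y v) :=
    calc iota (I.q y)
        = ((∏ v, sgn (z v && y v)) * ∏ v, sgn (z v && y v)) * iota (I.q y) := by rw [hss, one_mul]
      _ = (∏ v, sgn (z v && y v)) * ((∏ v, sgn (z v && y v)) * iota (I.q y)) := by ring
      _ = ∏ v, sgn (z v && y v) := by rw [hK, mul_one]
  apply iota_injective
  rw [h2, Finset.mul_sum, iota_sum]
  refine Finset.prod_congr rfl fun v _ => ?_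
  generalize z v = a
  generalize y v = b
  cases a <;> cases b <;> simp [sgn, iota_zero, iota_two]

open SimpleGraph

/-! ### Grid edges: injectivity, disjointness and the enumeration of ordered adjacent pairs -/

/-- Row of the tail of the `k`-th horizontal edge (definitional).
[cite: BravyiGossetKonigScience2018, §3 Fig. 1] -/
@[simp] theorem hEdge_fst_fst (k : Fin (N * (N - 1))) :
    (hEdge k).1.1 = (finProdFinEquiv.symm k).1 := rfl

/-- Column of the tail of the `k`-th horizontal edge (definitional).
[cite: BravyiGossetKonigScience2018, §3 Fig. 1] -/
@[simp] theorem hEdge_fst_snd_val (k : Fin (N * (N - 1))) :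
    ((hEdge k).1.2 : ℕ) = (finProdFinEquiv.symm k).2 := rfl

/-- Row of the head of the `k`-th horizontal edge (definitional).
[cite: BravyiGossetKonigScience2018, §3 Fig. 1] -/
@[simp] theorem hEdge_snd_fst (k : Fin (N * (N - 1))) :
    (hEdge k).2.1 = (finProdFinEquiv.symm k).1 := rfl

/-- Column of the head of the `k`-th horizontal edge (definitional).
[cite: BravyiGossetKonigScience2018, §3 Fig. 1] -/
@[simp] theorem hEdge_snd_snd_val (k : Fin (N * (N - 1))) :
    ((hEdge k).2.2 : ℕ) = (finProdFinEquiv.symm k).2 + 1 := rfl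

/-- Row of the tail of the `k`-th vertical edge (definitional).
[cite: BravyiGossetKonigScience2018, §3 Fig. 1] -/
@[simp] theorem vEdge_fst_fst_val (k : Fin (N * (N - 1))) :
    ((vEdge k).1.1 : ℕ) = (finProdFinEquiv.symm k).2 := rfl

/-- Column of the tail of the `k`-th vertical edge (definitional).
[cite: BravyiGossetKonigScience2018, §3 Fig. 1] -/
@[simp] theorem vEdge_fst_snd (k : Fin (N * (N - 1))) :
    (vEdge k).1.2 = (finProdFinEquiv.symm k).1 := rfl

/-- Row of the head of the `k`-th vertical edge (definitional).
[cite: BravyiGossetKonigScience2018, §3 Fig. 1] -/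
@[simp] theorem vEdge_snd_fst_val (k : Fin (N * (N - 1))) :
    ((vEdge k).2.1 : ℕ) = (finProdFinEquiv.symm k).2 + 1 := rfl

/-- Column of the head of the `k`-th vertical edge (definitional).
[cite: BravyiGossetKonigScience2018, §3 Fig. 1] -/
@[simp] theorem vEdge_snd_snd (k : Fin (N * (N - 1))) :
    (vEdge k).2.2 = (finProdFinEquiv.symm k).1 := rfl

/-- An edge index `k ↔ (i, j)` is determined by `i` and the value of `j`. [folklore] -/
theorem edgeIdx_ext {k k' : Fin (N * (N - 1))}
    (h1 : (finProdFinEquiv.symm k).1 = (finProdFinEquiv.symm k').1)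
    (h2 : ((finProdFinEquiv.symm k).2 : ℕ) = (finProdFinEquiv.symm k').2) : k = k' :=
  finProdFinEquiv.symm.injective (Prod.ext h1 (Fin.ext h2))

/-- Horizontal edges are determined by their tails. [cite: BravyiGossetKonigScience2018, §3 Fig. 1]
-/
theorem hEdge_fst_inj {k k' : Fin (N * (N - 1))} (h : (hEdge k).1 = (hEdge k').1) : k = k' :=
  edgeIdx_ext (by simpa using congrArg Prod.fst h)
    (by simpa using congrArg (fun v : Fin N × Fin N => (v.2 : ℕ)) h)

/-- Horizontal edges are determined by their heads. [cite: BravyiGossetKonigScience2018, §3 Fig. 1]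
-/
theorem hEdge_snd_inj {k k' : Fin (N * (N - 1))} (h : (hEdge k).2 = (hEdge k').2) : k = k' :=
  edgeIdx_ext (by simpa using congrArg Prod.fst h)
    (by simpa using congrArg (fun v : Fin N × Fin N => (v.2 : ℕ)) h)

/-- If the tail of one horizontal edge is the head of another, their columns differ by one.
[cite: BravyiGossetKonigScience2018, §3 Fig. 1] -/
theorem hEdge_fst_eq_snd {k k' : Fin (N * (N - 1))} (h : (hEdge k).1 = (hEdge k').2) :
    ((finProdFinEquiv.symm k).2 : ℕ) = (finProdFinEquiv.symm k').2 + 1 := by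
  simpa using congrArg (fun v : Fin N × Fin N => (v.2 : ℕ)) h

/-- Vertical edges are determined by their tails. [cite: BravyiGossetKonigScience2018, §3 Fig. 1] -/
theorem vEdge_fst_inj {k k' : Fin (N * (N - 1))} (h : (vEdge k).1 = (vEdge k').1) : k = k' :=
  edgeIdx_ext (by simpa using congrArg Prod.snd h)
    (by simpa using congrArg (fun v : Fin N × Fin N => (v.1 : ℕ)) h)

/-- Vertical edges are determined by their heads. [cite: BravyiGossetKonigScience2018, §3 Fig. 1] -/
theorem vEdge_snd_inj {k k' : Fin (N * (N - 1))} (h : (vEdge k).2 = (vEdge k').2) : k = k' :=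
  edgeIdx_ext (by simpa using congrArg Prod.snd h)
    (by simpa using congrArg (fun v : Fin N × Fin N => (v.1 : ℕ)) h)

/-- If the tail of one vertical edge is the head of another, their (row) indices differ by one.
[cite: BravyiGossetKonigScience2018, §3 Fig. 1] -/
theorem vEdge_fst_eq_snd {k k' : Fin (N * (N - 1))} (h : (vEdge k).1 = (vEdge k').2) :
    ((finProdFinEquiv.symm k).2 : ℕ) = (finProdFinEquiv.symm k').2 + 1 := by
  simpa using congrArg (fun v : Fin N × Fin N => (v.1 : ℕ)) h

/-- The enumeration of horizontal edges is injective.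
[cite: BravyiGossetKonigScience2018, §3 Fig. 1] -/
theorem hEdge_injective : Function.Injective (hEdge (N := N)) := fun _ _ h =>
  hEdge_fst_inj (congrArg Prod.fst h)

/-- The enumeration of vertical edges is injective. [cite: BravyiGossetKonigScience2018, §3 Fig. 1]
-/
theorem vEdge_injective : Function.Injective (vEdge (N := N)) := fun _ _ h =>
  vEdge_fst_inj (congrArg Prod.fst h)

/-- No ordered pair is both a listed horizontal and a listed vertical edge.
[cite: BravyiGossetKonigScience2018, §3 Fig. 1] -/
theorem hEdge_ne_vEdge (k k' : Fin (N * (N - 1))) : hEdge k ≠ vEdge k' := by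
  intro h
  have h1 := congrArg (fun e : (Fin N × Fin N) × (Fin N × Fin N) => (e.1.1 : ℕ)) h
  have h2 := congrArg (fun e : (Fin N × Fin N) × (Fin N × Fin N) => (e.2.1 : ℕ)) h
  simp only [hEdge_fst_fst, hEdge_snd_fst, vEdge_fst_fst_val, vEdge_snd_fst_val] at h1 h2
  omega

/-- Horizontal edges are not loops. [cite: BravyiGossetKonigScience2018, §3 Fig. 1] -/
theorem hEdge_fst_ne_snd (k : Fin (N * (N - 1))) : (hEdge k).1 ≠ (hEdge k).2 :=
  (gridGraph_adj_hEdge k).ne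

/-- Vertical edges are not loops. [cite: BravyiGossetKonigScience2018, §3 Fig. 1] -/
theorem vEdge_fst_ne_snd (k : Fin (N * (N - 1))) : (vEdge k).1 ≠ (vEdge k).2 :=
  (gridGraph_adj_vEdge k).ne

/-- If there is an edge index then `N > 0`. [folklore] -/
theorem pos_of_edgeIdx (k : Fin (N * (N - 1))) : 0 < N := by
  rcases Nat.eq_zero_or_pos N with h | h
  · subst h
    exact absurd k.isLt (by simp)
  · exact h

/-- Horizontal edges are listed tail-before-head in row-major order.
[cite: BravyiGossetKonigScience2018, §3 Fig. 1] -/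
theorem hEdge_lt (k : Fin (N * (N - 1))) :
    finProdFinEquiv (hEdge k).1 < finProdFinEquiv (hEdge k).2 := by
  rw [Fin.lt_def, finProdFinEquiv_apply_val, finProdFinEquiv_apply_val]
  simp

/-- Vertical edges are listed tail-before-head in row-major order.
[cite: BravyiGossetKonigScience2018, §3 Fig. 1] -/
theorem vEdge_lt (k : Fin (N * (N - 1))) :
    finProdFinEquiv (vEdge k).1 < finProdFinEquiv (vEdge k).2 := by
  rw [Fin.lt_def, finProdFinEquiv_apply_val, finProdFinEquiv_apply_val]
  simp only [vEdge_fst_fst_val, vEdge_fst_snd, vEdge_snd_fst_val, vEdge_snd_snd]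
  have := pos_of_edgeIdx k
  rw [Nat.mul_succ]
  omega

/-- Every ordered adjacent pair `u < v` (row-major) of the grid is a listed horizontal or vertical
edge. [cite: BravyiGossetKonigScience2018, §3 Fig. 1] -/
theorem exists_edge_of_adj {u v : Fin N × Fin N} (hadj : (gridGraph N).Adj u v)
    (hlt : finProdFinEquiv u < finProdFinEquiv v) :
    (∃ k, hEdge k = (u, v)) ∨ (∃ k, vEdge k = (u, v)) := by
  rw [Fin.lt_def, finProdFinEquiv_apply_val, finProdFinEquiv_apply_val] at hlt
  rcases boxProd_adj.1 hadj with ⟨h1, h2⟩ | ⟨h1, h2⟩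
  · -- the first coordinates are adjacent on the path, the second agree: a vertical edge
    have h2' : (u.2 : ℕ) = v.2 := congrArg Fin.val h2
    rw [pathGraph_adj] at h1
    rcases h1 with h1 | h1
    · right
      have hu : (u.1 : ℕ) < N - 1 := by have := v.1.isLt; omega
      refine ⟨finProdFinEquiv (u.2, ⟨u.1, hu⟩), ?_⟩
      refine Prod.ext (Prod.ext (Fin.ext ?_) ?_) (Prod.ext (Fin.ext ?_) ?_)
      · rw [vEdge_fst_fst_val, Equiv.symm_apply_apply]
      · rw [vEdge_fst_snd, Equiv.symm_apply_apply]
      · rw [vEdge_snd_fst_val, Equiv.symm_apply_apply]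
        exact h1
      · rw [vEdge_snd_snd, Equiv.symm_apply_apply]
        exact h2
    · exfalso
      have key : N * (u.1 : ℕ) = N * v.1 + N := by rw [← h1]; ring
      omega
  · -- the second coordinates are adjacent, the first agree: a horizontal edge
    have h2' : (u.1 : ℕ) = v.1 := congrArg Fin.val h2
    rw [pathGraph_adj] at h1
    rcases h1 with h1 | h1
    · left
      have hu : (u.2 : ℕ) < N - 1 := by have := v.2.isLt; omega
      refine ⟨finProdFinEquiv (u.1, ⟨u.2, hu⟩), ?_⟩
      refine Prod.ext (Prod.ext ?_ (Fin.ext ?_)) (Prod.ext ?_ (Fin.ext ?_))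
      · rw [hEdge_fst_fst, Equiv.symm_apply_apply]
      · rw [hEdge_fst_snd_val, Equiv.symm_apply_apply]
      · rw [hEdge_snd_fst, Equiv.symm_apply_apply]
        exact h2
      · rw [hEdge_snd_snd_val, Equiv.symm_apply_apply]
        exact h1
    · exfalso
      have key : N * (u.1 : ℕ) = N * v.1 := by rw [h2']
      omega

/-- **Grid-edge enumeration.** A product over ordered pairs of grid vertices of a function that is
`1` off the ordered adjacent pairs `u < v` splits as the product over the listed horizontal edges
times the product over the listed vertical edges (`Σ_{α<β} A_{αβ} x_α x_β` runs over the grid edges,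
`A` being supported on nearest neighbours).
[cite: BravyiGossetKonigScience2018, §3 (2D HLF, A supported on grid edges)] -/
theorem prod_prod_eq_prod_hEdge_mul_prod_vEdge (f : Fin N × Fin N → Fin N × Fin N → ℂ)
    (hf : ∀ u v, f u v ≠ 1 → (gridGraph N).Adj u v ∧ finProdFinEquiv u < finProdFinEquiv v) :
    ∏ u, ∏ v, f u v = (∏ k, f (hEdge k).1 (hEdge k).2) * ∏ k, f (vEdge k).1 (vEdge k).2 := by
  classical
  let hE : Fin (N * (N - 1)) ↪ (Fin N × Fin N) × (Fin N × Fin N) := ⟨hEdge, hEdge_injective⟩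
  let vE : Fin (N * (N - 1)) ↪ (Fin N × Fin N) × (Fin N × Fin N) := ⟨vEdge, vEdge_injective⟩
  have hdisj : Disjoint (Finset.univ.map hE) (Finset.univ.map vE) := by
    rw [Finset.disjoint_left]
    intro p hp hq
    simp only [Finset.mem_map, Finset.mem_univ, true_and] at hp hq
    obtain ⟨k, rfl⟩ := hp
    obtain ⟨k', hk'⟩ := hq
    exact hEdge_ne_vEdge k k' hk'.symm
  set E := (Finset.univ.map hE).disjUnion (Finset.univ.map vE) hdisj with hEdef
  have hvan : ∀ p ∈ (Finset.univ : Finset ((Fin N × Fin N) × (Fin N × Fin N))), p ∉ E →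
      f p.1 p.2 = 1 := by
    intro p _ hp
    by_contra hne
    obtain ⟨hadj, hlt⟩ := hf p.1 p.2 hne
    apply hp
    rw [hEdef, Finset.mem_disjUnion]
    rcases exists_edge_of_adj hadj hlt with ⟨k, hk⟩ | ⟨k, hk⟩
    · exact Or.inl (Finset.mem_map.2 ⟨k, Finset.mem_univ _, hk⟩)
    · exact Or.inr (Finset.mem_map.2 ⟨k, Finset.mem_univ _, hk⟩)
  rw [← Fintype.prod_prod_type', ← Finset.prod_subset (Finset.subset_univ E) hvan, hEdef,
    Finset.prod_disjUnion, Finset.prod_map, Finset.prod_map]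
  rfl

/-! ### The circuit: wires, blocks, stages -/

/-- Data wire `j` (the `j`-th ancilla; BGK's data register).
[cite: BravyiGossetKonigScience2018, §3 Fig. 1] -/
def dataW (j : Fin (N * N)) : Fin (inLen N + N * N) := Fin.natAdd (inLen N) j

/-- Input wire holding `A` on the `k`-th horizontal edge (see `encodeHLF`).
[cite: BravyiGossetKonigScience2018, Theorem 1 (input layout of Fig. 1)] -/
def hInW (k : Fin (N * (N - 1))) : Fin (inLen N + N * N) :=
  Fin.castAdd (N * N) (Fin.castAdd (N * N) (Fin.castAdd (N * (N - 1)) k))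

/-- Input wire holding `A` on the `k`-th vertical edge (see `encodeHLF`).
[cite: BravyiGossetKonigScience2018, Theorem 1 (input layout of Fig. 1)] -/
def vInW (k : Fin (N * (N - 1))) : Fin (inLen N + N * N) :=
  Fin.castAdd (N * N) (Fin.castAdd (N * N) (Fin.natAdd (N * (N - 1)) k))

/-- Input wire holding `b` at data index `j` (see `encodeHLF`).
[cite: BravyiGossetKonigScience2018, Theorem 1 (input layout of Fig. 1)] -/
def bInW (j : Fin (N * N)) : Fin (inLen N + N * N) :=
  Fin.castAdd (N * N) (Fin.natAdd (N * (N - 1) + N * (N - 1)) j)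

/-- Distinct data indices have distinct data wires. [folklore] -/
theorem dataW_injective : Function.Injective (dataW (N := N)) := Fin.natAdd_injective _ _

/-- Distinct horizontal edges have distinct input wires. [folklore] -/
theorem hInW_injective : Function.Injective (hInW (N := N)) := fun _ _ h =>
  Fin.castAdd_injective _ _ (Fin.castAdd_injective _ _ (Fin.castAdd_injective _ _ h))

/-- Distinct vertical edges have distinct input wires. [folklore] -/
theorem vInW_injective : Function.Injective (vInW (N := N)) := fun _ _ h =>
  Fin.natAdd_injective _ _ (Fin.castAdd_injective _ _ (Fin.castAdd_injective _ _ h))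

/-- Input wires are not data wires. [folklore] -/
theorem castAdd_ne_dataW (i : Fin (inLen N)) (j : Fin (N * N)) :
    Fin.castAdd (N * N) i ≠ dataW j := by
  intro h
  have := congrArg Fin.val h
  simp [dataW] at this
  omega

/-- Horizontal-edge input wires are not data wires. [folklore] -/
theorem hInW_ne_dataW (k : Fin (N * (N - 1))) (j : Fin (N * N)) : hInW k ≠ dataW j :=
  castAdd_ne_dataW _ _

/-- Vertical-edge input wires are not data wires. [folklore] -/
theorem vInW_ne_dataW (k : Fin (N * (N - 1))) (j : Fin (N * N)) : vInW k ≠ dataW j :=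
  castAdd_ne_dataW _ _

/-- `b`-input wires are not data wires. [folklore] -/
theorem bInW_ne_dataW (j j' : Fin (N * N)) : bInW j ≠ dataW j' :=
  castAdd_ne_dataW _ _

/-- On `|encodeHLF I⟩ ⊗ |x⟩` the input wire of the `k`-th horizontal edge `(u, v)` holds `A_{uv}`.
[cite: BravyiGossetKonigScience2018, Theorem 1 (input layout of Fig. 1)] -/
theorem append_hInW (I : HLFInstance N) (x : QReg (N * N)) (k : Fin (N * (N - 1))) :
    Fin.append (encodeHLF I) x (hInW k) = I.A (hEdge k).1 (hEdge k).2 := by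
  rw [hInW, Fin.append_left, encodeHLF, Fin.append_left, Fin.append_left]

/-- On `|encodeHLF I⟩ ⊗ |x⟩` the input wire of the `k`-th vertical edge `(u, v)` holds `A_{uv}`.
[cite: BravyiGossetKonigScience2018, Theorem 1 (input layout of Fig. 1)] -/
theorem append_vInW (I : HLFInstance N) (x : QReg (N * N)) (k : Fin (N * (N - 1))) :
    Fin.append (encodeHLF I) x (vInW k) = I.A (vEdge k).1 (vEdge k).2 := by
  rw [vInW, Fin.append_left, encodeHLF, Fin.append_left, Fin.append_right]

/-- On `|encodeHLF I⟩ ⊗ |x⟩` the `j`-th `b`-input wire holds `b` at the `j`-th vertex.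
[cite: BravyiGossetKonigScience2018, Theorem 1 (input layout of Fig. 1)] -/
theorem append_bInW (I : HLFInstance N) (x : QReg (N * N)) (j : Fin (N * N)) :
    Fin.append (encodeHLF I) x (bInW j) = I.b (finProdFinEquiv.symm j) := by
  rw [bInW, Fin.append_left, encodeHLF, Fin.append_right]

/-- On `|e⟩ ⊗ |x⟩` the `j`-th data wire holds `x_j`. [folklore] -/
theorem append_dataW (e : QReg (inLen N)) (x : QReg (N * N)) (j : Fin (N * N)) :
    Fin.append e x (dataW j) = x j :=
  Fin.append_right _ _ _

/-- The `CCZ` block of the `k`-th horizontal edge `(u, v)`: the landed `CCZ` word `cczWord` on the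
input wire of `A_{uv}` and the data wires of `u` and `v` (a factor of the controlled-`CZ(A)` gate,
BGK Eq. (9)).
[cite: BravyiGossetKonigScience2018, proof of Theorem 1, p. 6] -/
def cczH (k : Fin (N * (N - 1))) : List (QGate cliffordT (inLen N + N * N)) :=
  cczWord (hInW k) (dataW (finProdFinEquiv (hEdge k).1)) (dataW (finProdFinEquiv (hEdge k).2))
    (hInW_ne_dataW _ _) (hInW_ne_dataW _ _)
    (fun h => hEdge_fst_ne_snd k (finProdFinEquiv.injective (dataW_injective h)))

/-- The `CCZ` block of the `k`-th vertical edge (a factor of the controlled-`CZ(A)` gate).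
[cite: BravyiGossetKonigScience2018, proof of Theorem 1, p. 6] -/
def cczV (k : Fin (N * (N - 1))) : List (QGate cliffordT (inLen N + N * N)) :=
  cczWord (vInW k) (dataW (finProdFinEquiv (vEdge k).1)) (dataW (finProdFinEquiv (vEdge k).2))
    (vInW_ne_dataW _ _) (vInW_ne_dataW _ _)
    (fun h => vEdge_fst_ne_snd k (finProdFinEquiv.injective (dataW_injective h)))

/-- The controlled-`S` block of data index `j`: control the input wire of `b_j`, target the data
wire `j` (a factor of the controlled-`S(b)` gate).
[cite: BravyiGossetKonigScience2018, proof of Theorem 1, p. 6] -/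
def csB (j : Fin (N * N)) : List (QGate cliffordT (inLen N + N * N)) :=
  csBlock (bInW j) (dataW j) (bInW_ne_dataW _ _)

/-- The Hadamard block of data index `j`. [cite: BravyiGossetKonigScience2018, §3 Fig. 1] -/
def hBlk (j : Fin (N * N)) : List (QGate cliffordT (inLen N + N * N)) := [hOn (dataW j)]

/-- Column parity of an edge index `k ↔ (i, j)`: `j mod 2` (used to split the grid edges into the
four matchings `E₁, …, E₄`). [cite: BravyiGossetKonigScience2018, proof of Theorem 1, p. 6] -/
def colPar (k : Fin (N * (N - 1))) : ℕ := ((finProdFinEquiv.symm k).2 : ℕ) % 2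

/-- Edge indices of even column. [cite: BravyiGossetKonigScience2018, proof of Theorem 1, p. 6] -/
def edgesEven : List (Fin (N * (N - 1))) :=
  (List.finRange (N * (N - 1))).filter fun k => decide (colPar k = 0)

/-- Edge indices of odd column. [cite: BravyiGossetKonigScience2018, proof of Theorem 1, p. 6] -/
def edgesOdd : List (Fin (N * (N - 1))) :=
  (List.finRange (N * (N - 1))).filter fun k => !decide (colPar k = 0)

variable (N) in
/-- The seven stages of the BGK circuit: `H` layer, four `CCZ` layers (horizontal/vertical edges of
even/odd column), the controlled-`S` layer, `H` layer.
[cite: BravyiGossetKonigScience2018, §3 Fig. 1 and proof of Theorem 1] -/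
def hlfStages : List (ℕ × List (List (QGate cliffordT (inLen N + N * N)))) :=
  [(1, (List.finRange (N * N)).map hBlk),
   (22, edgesEven.map cczH), (22, edgesOdd.map cczH),
   (22, edgesEven.map cczV), (22, edgesOdd.map cczV),
   (8, (List.finRange (N * N)).map csB),
   (1, (List.finRange (N * N)).map hBlk)]

variable (N) in
/-- **The BGK circuit** for 2D HLF on the `N × N` grid, over Clifford+`T`, on the `inLen N` input
wires and `N²` data wires: `H^{⊗n}`, controlled-`CZ(A)` as `CCZ` gates in four layers,
controlled-`S(b)` as `CS` gates, `H^{⊗n}`, all compiled exactly into `{H, S, T, CNOT}`. (A concrete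
gate list; `noncomputable` only because the tree's gate-set constant `cliffordT` is.)
[cite: BravyiGossetKonigScience2018, §3 Fig. 1 and Theorem 1] -/
noncomputable def hlfCircuit : QCircuit cliffordT (inLen N + N * N) :=
  ⟨QCircuit.stagesGates (hlfStages N)⟩

/-- The output wires: the data wire of each grid vertex (BGK measure the data register).
[cite: BravyiGossetKonigScience2018, §3 Fig. 1] -/
def hlfOut (v : Fin N × Fin N) : Fin (inLen N + N * N) := dataW (finProdFinEquiv v)

/-- The output wires are distinct. [cite: BravyiGossetKonigScience2018, Theorem 1] -/
theorem hlfOut_injective : Function.Injective (hlfOut (N := N)) := fun _ _ h =>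
  finProdFinEquiv.injective (dataW_injective h)

/-! ### Depth and oracle-freeness -/

/-- Members of `edgesEven` have even column. [folklore] -/
theorem colPar_of_mem_edgesEven {k : Fin (N * (N - 1))} (h : k ∈ (edgesEven : List _)) :
    colPar k = 0 := by
  simpa [edgesEven] using h

/-- Members of `edgesOdd` have odd column. [folklore] -/
theorem colPar_of_mem_edgesOdd {k : Fin (N * (N - 1))} (h : k ∈ (edgesOdd : List _)) :
    colPar k = 1 := by
  have h' : colPar k ≠ 0 := by simpa [edgesOdd] using h
  have : colPar k < 2 := Nat.mod_lt _ two_pos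
  omega

/-- `CCZ` blocks of distinct horizontal edges of equal column parity act on disjoint wires (BGK: "no
edges within a given layer share a vertex").
[cite: BravyiGossetKonigScience2018, proof of Theorem 1, p. 6] -/
theorem disjoint_cczH {k k' : Fin (N * (N - 1))} (hne : k ≠ k') (hpar : colPar k = colPar k') :
    Disjoint (QCircuit.blockWires (cczH k)) (QCircuit.blockWires (cczH k')) := by
  rw [Finset.disjoint_left]
  intro i hi hi'
  unfold colPar at hpar
  rcases mem_blockWires_cczWord hi with rfl | rfl | rfl <;>
    rcases mem_blockWires_cczWord hi' with h | h | h
  · exact hne (hInW_injective h)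
  · exact hInW_ne_dataW _ _ h
  · exact hInW_ne_dataW _ _ h
  · exact hInW_ne_dataW _ _ h.symm
  · exact hne (hEdge_fst_inj (finProdFinEquiv.injective (dataW_injective h)))
  · have := hEdge_fst_eq_snd (finProdFinEquiv.injective (dataW_injective h))
    omega
  · exact hInW_ne_dataW _ _ h.symm
  · have := hEdge_fst_eq_snd (finProdFinEquiv.injective (dataW_injective h)).symm
    omega
  · exact hne (hEdge_snd_inj (finProdFinEquiv.injective (dataW_injective h)))

/-- `CCZ` blocks of distinct vertical edges of equal column parity act on disjoint wires.
[cite: BravyiGossetKonigScience2018, proof of Theorem 1, p. 6] -/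
theorem disjoint_cczV {k k' : Fin (N * (N - 1))} (hne : k ≠ k') (hpar : colPar k = colPar k') :
    Disjoint (QCircuit.blockWires (cczV k)) (QCircuit.blockWires (cczV k')) := by
  rw [Finset.disjoint_left]
  intro i hi hi'
  unfold colPar at hpar
  rcases mem_blockWires_cczWord hi with rfl | rfl | rfl <;>
    rcases mem_blockWires_cczWord hi' with h | h | h
  · exact hne (vInW_injective h)
  · exact vInW_ne_dataW _ _ h
  · exact vInW_ne_dataW _ _ h
  · exact vInW_ne_dataW _ _ h.symm
  · exact hne (vEdge_fst_inj (finProdFinEquiv.injective (dataW_injective h)))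
  · have := vEdge_fst_eq_snd (finProdFinEquiv.injective (dataW_injective h))
    omega
  · exact vInW_ne_dataW _ _ h.symm
  · have := vEdge_fst_eq_snd (finProdFinEquiv.injective (dataW_injective h)).symm
    omega
  · exact hne (vEdge_snd_inj (finProdFinEquiv.injective (dataW_injective h)))

/-- The Hadamard layer is a stage of width `1`.
[cite: BravyiGossetKonigScience2018, proof of Theorem 1, p. 6] -/
theorem isStage_hBlk : QCircuit.IsStage 1 ((List.finRange (N * N)).map (hBlk (N := N))) :=
  QCircuit.isStage_map 1 hBlk _ (List.nodup_finRange _) (fun _ _ => le_rfl)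
    fun j _ j' _ hne => by
      rw [hBlk, hBlk, blockWires_hBlock, blockWires_hBlock, Finset.disjoint_singleton]
      exact fun h => hne (dataW_injective h)

/-- The `CCZ` blocks of the horizontal edges of even column form a stage of width `22` (edge layer
`E₁`). [cite: BravyiGossetKonigScience2018, proof of Theorem 1, p. 6] -/
theorem isStage_cczH_even : QCircuit.IsStage 22 (edgesEven.map (cczH (N := N))) :=
  QCircuit.isStage_map 22 cczH _ ((List.nodup_finRange _).filter _) (fun _ _ => le_of_eq rfl)
    fun _ hk _ hk' hne => disjoint_cczH hne
      (by rw [colPar_of_mem_edgesEven hk, colPar_of_mem_edgesEven hk'])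

/-- The `CCZ` blocks of the horizontal edges of odd column form a stage of width `22` (edge layer
`E₂`). [cite: BravyiGossetKonigScience2018, proof of Theorem 1, p. 6] -/
theorem isStage_cczH_odd : QCircuit.IsStage 22 (edgesOdd.map (cczH (N := N))) :=
  QCircuit.isStage_map 22 cczH _ ((List.nodup_finRange _).filter _) (fun _ _ => le_of_eq rfl)
    fun _ hk _ hk' hne => disjoint_cczH hne
      (by rw [colPar_of_mem_edgesOdd hk, colPar_of_mem_edgesOdd hk'])

/-- The `CCZ` blocks of the vertical edges of even column form a stage of width `22` (edge layer
`E₃`). [cite: BravyiGossetKonigScience2018, proof of Theorem 1, p. 6] -/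
theorem isStage_cczV_even : QCircuit.IsStage 22 (edgesEven.map (cczV (N := N))) :=
  QCircuit.isStage_map 22 cczV _ ((List.nodup_finRange _).filter _) (fun _ _ => le_of_eq rfl)
    fun _ hk _ hk' hne => disjoint_cczV hne
      (by rw [colPar_of_mem_edgesEven hk, colPar_of_mem_edgesEven hk'])

/-- The `CCZ` blocks of the vertical edges of odd column form a stage of width `22` (edge layer
`E₄`). [cite: BravyiGossetKonigScience2018, proof of Theorem 1, p. 6] -/
theorem isStage_cczV_odd : QCircuit.IsStage 22 (edgesOdd.map (cczV (N := N))) :=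
  QCircuit.isStage_map 22 cczV _ ((List.nodup_finRange _).filter _) (fun _ _ => le_of_eq rfl)
    fun _ hk _ hk' hne => disjoint_cczV hne
      (by rw [colPar_of_mem_edgesOdd hk, colPar_of_mem_edgesOdd hk'])

/-- The controlled-`S` blocks form a stage of width `8` ("a layer of two-qubit controlled-`S`
gates ... acting on disjoint pairs of qubits").
[cite: BravyiGossetKonigScience2018, proof of Theorem 1, p. 6] -/
theorem isStage_csB : QCircuit.IsStage 8 ((List.finRange (N * N)).map (csB (N := N))) :=
  QCircuit.isStage_map 8 csB _ (List.nodup_finRange _) (fun _ _ => le_of_eq rfl)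
    fun j _ j' _ hne => by
      rw [Finset.disjoint_left]
      intro i hi hi'
      rcases mem_blockWires_csBlock hi with rfl | rfl <;>
        rcases mem_blockWires_csBlock hi' with h | h
      · exact hne (Fin.natAdd_injective _ _ (Fin.castAdd_injective _ _ h))
      · exact bInW_ne_dataW _ _ h
      · exact bInW_ne_dataW _ _ h.symm
      · exact hne (dataW_injective h)

/-- **Constant depth.** The BGK circuit has depth at most `1 + 4·22 + 8 + 1 = 98` ("depth `d =
O(1)`"). [cite: BravyiGossetKonigScience2018, Theorem 1] -/
theorem hlfCircuit_depth_le : (hlfCircuit N).depth ≤ 98 := by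
  have h := QCircuit.depth_stagesGates_le (hlfStages N) ?_
  · exact h
  · intro p hp
    simp only [hlfStages, List.mem_cons, List.mem_nil_iff, or_false] at hp
    rcases hp with rfl | rfl | rfl | rfl | rfl | rfl | rfl
    exacts [isStage_hBlk, isStage_cczH_even, isStage_cczH_odd, isStage_cczV_even,
      isStage_cczV_odd, isStage_csB, isStage_hBlk]

/-- The BGK circuit is oracle-free (it consists of gate symbols only).
[cite: BravyiGossetKonigScience2018, Theorem 1] -/
theorem hlfCircuit_isOracleFree : (hlfCircuit N).IsOracleFree := by
  apply QCircuit.isOracleFree_stagesGates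
  intro p hp b hb g hg
  simp only [hlfStages, List.mem_cons, List.mem_nil_iff, or_false] at hp
  rcases hp with rfl | rfl | rfl | rfl | rfl | rfl | rfl <;>
    obtain ⟨i, -, rfl⟩ := List.mem_map.1 hb
  exacts [isOracleFree_of_mem_hBlock hg, cczWord_isOracleFree _ _ _ _ _ _ _ hg,
    cczWord_isOracleFree _ _ _ _ _ _ _ hg, cczWord_isOracleFree _ _ _ _ _ _ _ hg,
    cczWord_isOracleFree _ _ _ _ _ _ _ hg, isOracleFree_of_mem_csBlock hg,
    isOracleFree_of_mem_hBlock hg]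

/-! ### Semantics -/

/-- The gates of the two Hadamard layers. [cite: BravyiGossetKonigScience2018, §3 Fig. 1] -/
def hGates : List (QGate cliffordT (inLen N + N * N)) :=
  ((List.finRange (N * N)).map hBlk).flatten

/-- The gates of the diagonal middle part `U_q` (controlled `CZ(A)` and `S(b)`).
[cite: BravyiGossetKonigScience2018, §3 Eq. (6)–(7)] -/
def midGates : List (QGate cliffordT (inLen N + N * N)) :=
  (edgesEven.map cczH).flatten ++ ((edgesOdd.map cczH).flatten ++
    ((edgesEven.map cczV).flatten ++ ((edgesOdd.map cczV).flatten ++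
      ((List.finRange (N * N)).map csB).flatten)))

/-- The gate list of the BGK circuit: Hadamard layer, middle part `U_q`, Hadamard layer.
[cite: BravyiGossetKonigScience2018, §3 Fig. 1] -/
theorem hlfCircuit_gates : (hlfCircuit N).gates = hGates ++ (midGates ++ hGates) := by
  simp [hlfCircuit, hlfStages, QCircuit.stagesGates, hGates, midGates]

/-- Phase of the `CCZ` block of a horizontal edge on a basis state.
[cite: BravyiGossetKonigScience2018, §3 Eq. (7)] -/
noncomputable def phaseH (k : Fin (N * (N - 1))) (y : QReg (inLen N + N * N)) : ℂ :=
  if (y (hInW k) && y (dataW (finProdFinEquiv (hEdge k).1)) &&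
      y (dataW (finProdFinEquiv (hEdge k).2))) then (-1 : ℂ) else 1

/-- Phase of the `CCZ` block of a vertical edge on a basis state.
[cite: BravyiGossetKonigScience2018, §3 Eq. (7)] -/
noncomputable def phaseV (k : Fin (N * (N - 1))) (y : QReg (inLen N + N * N)) : ℂ :=
  if (y (vInW k) && y (dataW (finProdFinEquiv (vEdge k).1)) &&
      y (dataW (finProdFinEquiv (vEdge k).2))) then (-1 : ℂ) else 1

/-- Phase of a controlled-`S` block on a basis state.
[cite: BravyiGossetKonigScience2018, §3 Eq. (7)] -/
noncomputable def phaseS (j : Fin (N * N)) (y : QReg (inLen N + N * N)) : ℂ :=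
  csPhase (y (bInW j)) (y (dataW j))

/-- The phase of the middle part on a basis state. [cite: BravyiGossetKonigScience2018, §3 Eq. (7)]
-/
noncomputable def midPhase (y : QReg (inLen N + N * N)) : ℂ :=
  (edgesEven.map fun k => phaseH k y).prod * ((edgesOdd.map fun k => phaseH k y).prod *
    ((edgesEven.map fun k => phaseV k y).prod * ((edgesOdd.map fun k => phaseV k y).prod *
      ((List.finRange (N * N)).map fun j => phaseS j y).prod)))

/-- The middle part acts diagonally on the computational basis with phase `midPhase`.
[cite: BravyiGossetKonigScience2018, §3 Eq. (7)] -/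
theorem midGates_mulVec_basisState (y : QReg (inLen N + N * N)) :
    (⟨midGates⟩ : QCircuit cliffordT (inLen N + N * N)).mat *ᵥ basisState y =
      midPhase y • basisState y := by
  have hH : ∀ k x, (⟨cczH k⟩ : QCircuit cliffordT (inLen N + N * N)).toMatrix 0 *ᵥ basisState x =
      phaseH k x • basisState x := fun k x => cczWord_mulVec_basisState _ _ _ _ _ _ 0 x
  have hV : ∀ k x, (⟨cczV k⟩ : QCircuit cliffordT (inLen N + N * N)).toMatrix 0 *ᵥ basisState x =
      phaseV k x • basisState x := fun k x => cczWord_mulVec_basisState _ _ _ _ _ _ 0 x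
  have hS : ∀ j x, (⟨csB j⟩ : QCircuit cliffordT (inLen N + N * N)).toMatrix 0 *ᵥ basisState x =
      phaseS j x • basisState x := fun j x => csBlock_mulVec 0 _ _ _ x
  have e1 := QCircuit.toMatrix_flatten_map_mulVec_basisState 0 cczH phaseH hH edgesEven
  have e2 := QCircuit.toMatrix_flatten_map_mulVec_basisState 0 cczH phaseH hH edgesOdd
  have e3 := QCircuit.toMatrix_flatten_map_mulVec_basisState 0 cczV phaseV hV edgesEven
  have e4 := QCircuit.toMatrix_flatten_map_mulVec_basisState 0 cczV phaseV hV edgesOdd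
  have e5 := QCircuit.toMatrix_flatten_map_mulVec_basisState 0 csB phaseS hS
    (List.finRange (N * N))
  exact QCircuit.toMatrix_append_mulVec_basisState 0 _ _ _ _ e1
    (QCircuit.toMatrix_append_mulVec_basisState 0 _ _ _ _ e2
      (QCircuit.toMatrix_append_mulVec_basisState 0 _ _ _ _ e3
        (QCircuit.toMatrix_append_mulVec_basisState 0 _ _ _ _ e4 e5))) y

/-- The middle part is the diagonal operator `diagonal midPhase`.
[cite: BravyiGossetKonigScience2018, §3 Eq. (7)] -/
theorem midGates_mat :
    (⟨midGates⟩ : QCircuit cliffordT (inLen N + N * N)).mat = Matrix.diagonal midPhase :=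
  eq_diagonal_of_mulVec_basisState midGates_mulVec_basisState

/-- The Hadamard layer of the circuit is `H^{⊗ n}` on the data register (closed form
`hLayerMatrix`).
[cite: BravyiGossetKonigScience2018, §3 Fig. 1] -/
theorem hGates_mat :
    (⟨hGates⟩ : QCircuit cliffordT (inLen N + N * N)).mat =
      hLayerMatrix (dataWires (inLen N) (N * N)) := by
  have hnd : ((List.finRange (N * N)).map (dataW (N := N))).Nodup :=
    (List.nodup_finRange _).map dataW_injective
  unfold QCircuit.mat hGates
  rw [show (List.finRange (N * N)).map hBlk =
      (List.finRange (N * N)).map (fun j => [hOn (dataW (N := N) j)]) from rfl,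
    QCircuit.toMatrix_hLayer 0 dataW _ hnd]
  congr 1
  ext i
  simp [mem_dataWires_iff, dataW]

/-- **Amplitudes of the BGK circuit.** On `|e⟩|0^n⟩` the output amplitude at `z` vanishes unless `z`
carries `e` on the input wires, and then equals `2^{-n} Σ_x (-1)^{z_D · x} Φ(e, x)` with `Φ` the
phase of the middle part (BGK Eq. (8)). [cite: BravyiGossetKonigScience2018, §3 Eq. (8)] -/
theorem hlfCircuit_amplitude (e : QReg (inLen N)) (z : QReg (inLen N + N * N)) :
    ((hlfCircuit N).mat *ᵥ basisState (padInput e (N * N))) z =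
      if (fun i => z (Fin.castAdd (N * N) i)) = e then
        invSqrt2 ^ (N * N) * ∑ x : QReg (N * N),
          (∏ j, sgn (z (dataW j) && x j)) * (midPhase (Fin.append e x) * invSqrt2 ^ (N * N))
      else 0 := by
  have hC : (hlfCircuit N).mat = (⟨hGates⟩ : QCircuit _ _).mat *
      ((⟨midGates⟩ : QCircuit _ _).mat * (⟨hGates⟩ : QCircuit _ _).mat) := by
    unfold QCircuit.mat
    rw [show hlfCircuit N = ⟨hGates ++ (midGates ++ hGates)⟩ from QCircuit.ext hlfCircuit_gates,
      QCircuit.toMatrix_append_list, QCircuit.toMatrix_append_list, Matrix.mul_assoc]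
  rw [hC, hGates_mat, midGates_mat, basisState_padInput, ← Matrix.mulVec_mulVec,
    ← Matrix.mulVec_mulVec, hLayerMatrix_dataWires_mulVec_tens, hadT_basisState_zero,
    diagonal_mulVec_tens, hLayerMatrix_dataWires_mulVec_tens, tens_apply, hadT_apply]
  rfl

/-- Even-column edges followed by odd-column edges enumerate all edges: the product of a phase over
both classes is the product over all edge indices. [folklore] -/
theorem prod_even_mul_prod_odd (f : Fin (N * (N - 1)) → ℂ) :
    ((edgesEven : List (Fin (N * (N - 1)))).map f).prod * ((edgesOdd : List _).map f).prod =
      ∏ k, f k := by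
  rw [← List.prod_append, ← List.map_append, Fin.prod_univ_def]
  exact (List.Perm.map f (List.filter_append_perm _ _)).prod_eq

/-- `i^1 = i`. [folklore] -/
theorem iota_one : iota 1 = Complex.I := by
  rw [iota, show (1 : ZMod 4).val = 1 from rfl, pow_one]

/-- `i^{q(x)} = ∏_{α<β} (-1)^{A_{αβ} x_α x_β} ∏_α i^{b_α x_α}` (from Eq. (1)).
[cite: BravyiGossetKonigScience2018, §3 Eq. (1) and (7)] -/
theorem iota_q (I : HLFInstance N) (x : Fin N × Fin N → Bool) :
    iota (I.q x) =
      (∏ u, ∏ v, if finProdFinEquiv u < finProdFinEquiv v ∧ I.A u v = true ∧ x u = true ∧ x v = true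
        then (-1 : ℂ) else 1) *
      ∏ v, if I.b v = true ∧ x v = true then Complex.I else 1 := by
  rw [HLFInstance.q, iota_add, two_mul, iota_add, iota_sum, iota_sum, ← sq, ← Finset.prod_pow]
  congr 1
  · refine Finset.prod_congr rfl fun u _ => ?_
    rw [iota_sum, ← Finset.prod_pow]
    refine Finset.prod_congr rfl fun v _ => ?_
    split_ifs
    · rw [iota_one, sq, Complex.I_mul_I]
    · rw [iota_zero, one_pow]
  · refine Finset.prod_congr rfl fun v _ => ?_
    split_ifs
    · exact iota_one
    · exact iota_zero

/-- **`U_q |x⟩ = i^{q(x)} |x⟩` (BGK Eq. (7)) for the vendored circuit** on a valid instance: the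
phase of the middle part on `|encodeHLF I⟩|x⟩` is `i^{q_I(x)}`.
[cite: BravyiGossetKonigScience2018, §3 Eq. (7)] -/
theorem midPhase_append_encode (I : HLFInstance N) (hI : I.IsValid) (x : QReg (N * N)) :
    midPhase (Fin.append (encodeHLF I) x) = iota (I.q fun v => x (finProdFinEquiv v)) := by
  have hH : ∀ k, phaseH k (Fin.append (encodeHLF I) x) =
      if I.A (hEdge k).1 (hEdge k).2 = true ∧ x (finProdFinEquiv (hEdge k).1) = true ∧
          x (finProdFinEquiv (hEdge k).2) = true then (-1 : ℂ) else 1 := by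
    intro k
    simp only [phaseH, append_hInW, append_dataW, Bool.and_eq_true, and_assoc]
  have hV : ∀ k, phaseV k (Fin.append (encodeHLF I) x) =
      if I.A (vEdge k).1 (vEdge k).2 = true ∧ x (finProdFinEquiv (vEdge k).1) = true ∧
          x (finProdFinEquiv (vEdge k).2) = true then (-1 : ℂ) else 1 := by
    intro k
    simp only [phaseV, append_vInW, append_dataW, Bool.and_eq_true, and_assoc]
  have hS : ∀ j, phaseS j (Fin.append (encodeHLF I) x) =
      if I.b (finProdFinEquiv.symm j) = true ∧ x j = true then Complex.I else 1 := by
    intro j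
    simp only [phaseS, append_bInW, append_dataW, csPhase, Bool.and_eq_true]
  have reassoc : ∀ a b c d e : ℂ, a * (b * (c * (d * e))) = (a * b) * ((c * d) * e) := by
    intros; ring
  rw [midPhase]
  simp only [hH, hV, hS]
  rw [reassoc, prod_even_mul_prod_odd, prod_even_mul_prod_odd, ← Fin.prod_univ_def, iota_q,
    prod_prod_eq_prod_hEdge_mul_prod_vEdge]
  · rw [mul_assoc]
    congr 1
    · exact Finset.prod_congr rfl fun k _ => by simp only [hEdge_lt k, true_and]
    congr 1
    · exact Finset.prod_congr rfl fun k _ => by simp only [vEdge_lt k, true_and]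
    · exact Fintype.prod_equiv finProdFinEquiv.symm _ _ fun j => by
        simp only [Equiv.apply_symm_apply]
  · intro u v huv
    have hc : finProdFinEquiv u < finProdFinEquiv v ∧ I.A u v = true ∧
        x (finProdFinEquiv u) = true ∧ x (finProdFinEquiv v) = true := by
      by_contra hc
      exact huv (if_neg hc)
    exact ⟨hI.2 u v hc.2.1, hc.1⟩

/-- Amplitudes on an encoded valid instance: `⟨e, z|Q_N|e, 0^n⟩ = 2^{-n} Γ(z)` (BGK Eq. (8), (10):
`p(z) = |⟨z|H^{⊗n} U_q H^{⊗n}|0^n⟩|² = 4^{-n}|Γ(𝔽₂ⁿ, z)|²`).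
[cite: BravyiGossetKonigScience2018, §3 Eq. (8) and Lemma 2 (proof)] -/
theorem hlfCircuit_amplitude_encode (I : HLFInstance N) (hI : I.IsValid)
    (z : QReg (inLen N + N * N)) :
    ((hlfCircuit N).mat *ᵥ basisState (padInput (encodeHLF I) (N * N))) z =
      if (fun i => z (Fin.castAdd (N * N) i)) = encodeHLF I then
        (invSqrt2 ^ (N * N) * invSqrt2 ^ (N * N)) * gamma I (fun v => z (hlfOut v))
      else 0 := by
  rw [hlfCircuit_amplitude]
  split_ifs with h
  · simp_rw [midPhase_append_encode I hI]
    rw [gamma, Finset.mul_sum, Finset.mul_sum]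
    refine Fintype.sum_equiv (finProdFinEquiv.symm.arrowCongr (Equiv.refl Bool)) _ _ fun x => ?_
    have hx : (finProdFinEquiv.symm.arrowCongr (Equiv.refl Bool)) x =
        fun v => x (finProdFinEquiv v) := funext fun v => by
      simp [Equiv.arrowCongr_apply]
    rw [hx]
    rw [Fintype.prod_equiv finProdFinEquiv (fun v => sgn (z (hlfOut v) && x (finProdFinEquiv v)))
      (fun j => sgn (z (dataW j) && x j)) (fun v => rfl)]
    ring
  · rfl

end BGK

open Cryptography BGK

/-! ### The theorem -/

/-- **Discharge of `hlf_quantum_constant_depth`** (Bravyi–Gosset–König 2018, Theorem 1, first half: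
"For each `N ≥ 2` there exists a quantum circuit `Q_N` of depth `d = O(1)` which deterministically
solves size-`N` instances of the 2D Hidden Linear Function problem", p. 6). Witnesses: `d = 98`, `m
= N²` ancillas, `C = hlfCircuit N`, `out = hlfOut`; the output distribution is supported on
solutions because every outcome with nonzero amplitude has `Γ(z) ≠ 0`
(`hlfCircuit_amplitude_encode`) and BGK Lemma 2 (⇒) (`mem_hlfSolutions_of_gamma_ne_zero`); the Born
rule without normalisation uses the landed discharges `QCircuit.outputPMF_apply_holds` and
`cliffordT_isUnitary_holds`. [cite: BravyiGossetKonigScience2018, Theorem 1] -/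
theorem hlf_quantum_constant_depth_holds : hlf_quantum_constant_depth := by
  refine ⟨98, fun N _ => ⟨N * N, hlfCircuit N, hlfOut, hlfOut_injective, hlfCircuit_isOracleFree,
    hlfCircuit_depth_le, ?_⟩⟩
  intro I hI
  rw [PMF.toOuterMeasure_apply_eq_one_iff]
  intro z hz
  rw [PMF.mem_support_iff,
    QCircuit.outputPMF_apply_holds cliffordT_isUnitary_holds 0 (hlfCircuit N) (encodeHLF I) z] at hz
  have hz' : ((hlfCircuit N).mat *ᵥ basisState (padInput (encodeHLF I) (N * N))) z ≠ 0 := by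
    intro h0
    apply hz
    change ENNReal.ofReal
      (‖((hlfCircuit N).mat *ᵥ basisState (padInput (encodeHLF I) (N * N))) z‖ ^ 2) = 0
    rw [h0, norm_zero, sq, zero_mul, ENNReal.ofReal_zero]
  rw [hlfCircuit_amplitude_encode I hI] at hz'
  apply mem_hlfSolutions_of_gamma_ne_zero
  intro hg
  apply hz'
  rw [hg, mul_zero, ite_self]

end Literature.Computability.QuantumComplexity
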